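import Summits.ValiantsHypothesis.ValiantsHypothesis.Theorems.BarrierLeverAnchoredDoorHitsLowerPairsStarArrow

/-!
# Route BarrierLever — support item `AnchoredDoorHitsLowerPairs` (stmt-ValiantsHypothesis-22510), line `anchored_peeling`:
# NODE TEXT «ORDERED STAR-LOWER» — the star-forest door restricted to MONOTONE star forests along a linear order of the vertices

Node file (`--supports stmt-ValiantsHypothesis-22510`; val-np-p1 g36). Closes NO item; nothing here bears on crux 14610 or on `VP ≠ VNP`, which is
NOT proved; `Stmt.conjStarLower` is NOT proved here.

THE SPECIALISATION. Place the row vertices and the column vertices on one line (positions `π b`, `σ e ∈ ℕ`). ORDERED WEIGHTS: a row vertex `b` may hang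
on a column centre `e` (`g b e ≠ 0`) only if `σ e < π b`, and a column vertex `e` may hang on a row centre `b` (`d b e ≠ 0`) only if `π b < σ e` — every
leaf hangs on an EARLIER centre; for each pair `(b, e)` at most one of `g b e`, `d b e` is nonzero (complementary, «Ferrers-shaped» supports). The
star-forest entry `StarDoor.starEntry g d A S` then counts the MONOTONE star forests on `A ⊔ S`. The two classical evaluation doors are the two
extreme orders (all column vertices first = `E(g)`; all row vertices first = `Eᵀ(d)`).

THE NODE `Stmt.conjStarOrdered`: every injective lower pair admits an order and ordered weights with nonsingular star block. It is a 1:1 STRONGER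
replacement of the door slot `Stmt.conjStarLower` (arrow `conjStarLower_of_conjStarOrdered`, hence `anchoredDoorHitsLowerPairs_of_conjStarOrdered`), with
half of the `2h²` weights forced to zero and a recursive structure (memo HOME/val-np-p1/g36/MEMO-valnp1-g36.md §2: removing the LAST vertex `b` turns the
rows `A ∋ b` into the derivative `∂_c K` of the smaller kernel in the fresh direction `c = g b ·`; removing the FIRST vertex turns them into generic
TRANSLATES; the last two vertices give a 2 × 2 jet whose top coefficient in `g b e*` is the balanced vertex pivot).
CENSUS (memo §3; lab + kit j338322, evidence on 22510): EVERY lower pair on ≤ 5+5 vertices (1 798 + 121 + 40 + … canonical pairs) has a nonsingular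
ordered specialisation; the canonical rule «each side sorted by increasing star size, sides alternating» has 0 failures on all pairs ≤ 5+5 and on the
rigid family `(K_{1,4m−2} ⊔ K₂, m·C₄)`, `(Q₃, K₆ − e)`, `(∂Δⁿ, Δⁿ⁻¹ ⊔ Δⁿ⁻¹)`; very unbalanced vertex counts (`2^[3]` vs 7 points) want the
points first (there the good orders are EXACTLY the orders satisfying Hall's condition for the Möbius support, memo §4). WHY IT MIGHT FAIL: one lower pair
all of whose ordered specialisations (all `(n+m)!` orders) are singular — none known; a refutation of this node does NOT refute `Stmt.conjStarLower`.
-/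

set_option linter.dupNamespace false

namespace Summit.ValiantsHypothesis.ValiantsHypothesis.Theorems.BarrierLever.AnchoredPeeling

open Finset

noncomputable section

namespace StarDoor

variable {K : Type*} [CommRing K] {h : ℕ}

/-- **Ordered weights.** With row positions `π` and column positions `σ`: a row leaf `b` hangs only on EARLIER column centres (`g b e ≠ 0 → σ e < π b`)
and a column leaf `e` only on earlier row centres (`d b e ≠ 0 → π b < σ e`). -/
def IsOrdered (π σ : Fin h → ℕ) (g d : Fin h → Fin h → K) : Prop :=
  (∀ b e, g b e ≠ 0 → σ e < π b) ∧ (∀ b e, d b e ≠ 0 → π b < σ e)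

/-- Ordered weights have complementary supports: `g b e * d b e = 0` for every pair `(b, e)`. -/
theorem IsOrdered.mul_eq_zero {π σ : Fin h → ℕ} {g d : Fin h → Fin h → K} (ho : IsOrdered π σ g d) (b e : Fin h) :
    g b e * d b e = 0 := by
  by_cases hg : g b e = 0
  · rw [hg, zero_mul]
  by_cases hd : d b e = 0
  · rw [hd, mul_zero]
  exact absurd (lt_trans (ho.1 b e hg) (ho.2 b e hd)) (lt_irrefl _)

/-- The evaluation door `E(g)` (`d = 0`) is the ordered specialisation «all column vertices first». -/
theorem isOrdered_evalDoor (g : Fin h → Fin h → K) : IsOrdered (fun _ => 1) (fun _ => 0) g (fun _ _ => 0) :=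
  ⟨fun _ _ _ => Nat.zero_lt_one, fun _ _ hd => absurd rfl hd⟩

/-- The transposed evaluation door `Eᵀ(d)` (`g = 0`) is the ordered specialisation «all row vertices first». -/
theorem isOrdered_evalDoor_transpose (d : Fin h → Fin h → K) : IsOrdered (fun _ => 0) (fun _ => 1) (fun _ _ => 0) d :=
  ⟨fun _ _ hg => absurd rfl hg, fun _ _ _ => Nat.zero_lt_one⟩

end StarDoor

/-- **NODE TEXT (val-np-p1 g36): ORDERED STAR-LOWER.** For all `h`, `r` and every pair of injective enumerations `u`, `w` of LOWER families of faces of the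
same size there are positions `π`, `σ` of the row and column vertices on a line and complex weights `g d` ORDERED for them (`StarDoor.IsOrdered`: every
leaf hangs on an earlier centre) making the star-forest block `(starEntry g d (u i) (w j))_{i j}` nonsingular. Implies `Stmt.conjStarLower`
(`conjStarLower_of_conjStarOrdered`). WHY IT MIGHT FAIL: a lower pair all of whose `(n+m)!` ordered specialisations are singular (none among all pairs on
`≤ 5+5` vertices, the rigid family `(K_{1,4m−2} ⊔ K₂, m·C₄)`, `(Q₃, K₆ − e)`, `(∂Δⁿ, 2Δⁿ⁻¹)`, cubes vs points / balls; kit j338322). -/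
def Stmt.conjStarOrdered : Prop :=
  ∀ (h r : ℕ) (u w : Fin r → Finset (Fin h)), Function.Injective u → Function.Injective w →
    IsLowerSet (Set.range u) → IsLowerSet (Set.range w) →
    ∃ (π σ : Fin h → ℕ) (g d : Fin h → Fin h → ℂ), StarDoor.IsOrdered π σ g d ∧
      (Matrix.of fun i j : Fin r => StarDoor.starEntry g d (u i) (w j)).det ≠ 0

/-- ORDERED STAR-LOWER ⟹ STAR-LOWER (forget the order). -/
theorem conjStarLower_of_conjStarOrdered (H : Stmt.conjStarOrdered) : Stmt.conjStarLower := by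
  intro h r u w hu hw hlu hlw
  obtain ⟨_, _, g, d, _, hdet⟩ := H h r u w hu hw hlu hlw
  exact ⟨g, d, hdet⟩

/-- **COMPOSITION BY NAME: `Stmt.conjStarOrdered → AnchoredDoorHitsLowerPairs`** (the support item, with `s = 2`, `h₀ = 0`). -/
theorem anchoredDoorHitsLowerPairs_of_conjStarOrdered (H : Stmt.conjStarOrdered) :
    Summit.ValiantsHypothesis.ValiantsHypothesis.Theses.BarrierLever.AnchoredDoorHitsLowerPairs :=
  anchoredDoorHitsLowerPairs_of_conjStarLower (conjStarLower_of_conjStarOrdered H)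

end

end Summit.ValiantsHypothesis.ValiantsHypothesis.Theorems.BarrierLever.AnchoredPeeling
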